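import Summits.QuantumAdvantage.AdviceFreeQNC0.AffBells28SubFibre
import HarnessLib

/-!
# L-36 part B, brick (L3) — TRULY-STUCK STRUCTURE: if no pair move can shrink the survivor set properly, the survivors are a local
# `±`-twin class on all unused coins (qn-lit g29; Summits-side sketch for the provers, namespace `AffBells29lit`)

The kill table of one pair move (`AffBells28.dPair`): a row blind on both coins always dies, a row reading exactly one coin never dies, a row
reading both coins dies under exactly one of the two sign types.  `pairSurv β U i j p q` is the successor of a survivor set `U` under the
move `{i,j}` with pattern bits `(p,q)` (so that `surv β x x₁ (L ++ [(i,j)]) = pairSurv β (surv β x x₁ L) i j (x₁ i) (x₁ j)`, `surv_append_pair`).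

**Theorem `stuck_locTwin` (PROVED).**  If `U ≠ ∅`, `|A| ≥ 3` and for all distinct `i, j ∈ A` and all pattern bits the successor
`pairSurv β U i j p q` is `∅` or `U` ("truly stuck": no valid step on `A`), then every coin of `A` is read by all of `U` or by none of `U`
(`stuck_support`), all of `U` have a common ratio on any two all-read coins (`stuck_ratio`), and hence any two rows of `U` are `LocTwin` or
`LocAnti` on `A` (`stuck_locTwin`).  This is the structural half of the untargeted halving engine (INBOX 2026-08-28 L-36 part B): once the engine
can make no further valid step, `IsClassIso` holds for every reference reading three unused coins.  Pure `Finset`/`ZMod 3` bookkeeping.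
-/

namespace Summit.QuantumAdvantage.AdviceFreeQNC0

namespace AffBells29lit

open Finset AffBells28

variable {N : ℕ}

/-- Signed value of coin `i` of row `h` under pattern bit `p` (the summand of `dPair`). -/
def sval (β : Fin N → Fin N → ZMod 3) (p : Bool) (h i : Fin N) : ZMod 3 := if p then -β h i else β h i

/-- Auxiliary `dPair_eq_sval` (qn-lit g29 L-36 E, `AffBells29Stuck.lean` sha16 e9c93a609284989d, verbatim). -/
theorem dPair_eq_sval (β : Fin N → Fin N → ZMod 3) (x₁ : Fin N → Bool) (h i j : Fin N) :
    dPair β x₁ h i j = sval β (x₁ i) h i + sval β (x₁ j) h j := rfl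

/-- Successor of the survivor set `U` under the pair move `{i,j}` with pattern bits `(p,q)`. -/
def pairSurv (β : Fin N → Fin N → ZMod 3) (U : Finset (Fin N)) (i j : Fin N) (p q : Bool) : Finset (Fin N) :=
  U.filter fun h => sval β p h i + sval β q h j ≠ 0

/-- Link with the tree's `surv`: appending one move filters the survivors by `pairSurv` at the pattern bits of `x₁`. -/
theorem surv_append_pair (β : Fin N → Fin N → ZMod 3) (x x₁ : Fin N → Bool) (L : List (Fin N × Fin N)) (i j : Fin N) :
    surv β x x₁ (L ++ [(i, j)]) = pairSurv β (surv β x x₁ L) i j (x₁ i) (x₁ j) := by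
  ext h
  simp only [surv, pairSurv, mem_filter, List.mem_append, List.mem_singleton, dPair_eq_sval]
  constructor
  · rintro ⟨hact, hall⟩
    exact ⟨⟨hact, fun p hp => hall p (Or.inl hp)⟩, hall (i, j) (Or.inr rfl)⟩
  · rintro ⟨⟨hact, hall⟩, hij⟩
    refine ⟨hact, fun p hp => ?_⟩
    rcases hp with hp | rfl
    · exact hall p hp
    · exact hij

/-! ### The kill table (finite facts over `ZMod 3`, by `decide`) -/

/-- Blind on both coins: dies under every pattern. -/
theorem kill_blind (a b : ZMod 3) (ha : a = 0) (hb : b = 0) (p q : Bool) :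
    (if p then -a else a) + (if q then -b else b) = 0 := by
  subst ha; subst hb; cases p <;> cases q <;> simp

/-- Reads exactly one coin: survives every pattern. -/
theorem surv_one_reader (a b : ZMod 3) (h : (a ≠ 0 ∧ b = 0) ∨ (a = 0 ∧ b ≠ 0)) (p q : Bool) :
    (if p then -a else a) + (if q then -b else b) ≠ 0 := by
  revert a b p q; decide

/-- Reads both coins: survives exactly one of the two sign types — with equal bits iff the ratio `a·b` is `1`, with different bits iff it is `2`. -/
theorem surv_both_iff (a b : ZMod 3) (ha : a ≠ 0) (hb : b ≠ 0) (p q : Bool) :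
    (if p then -a else a) + (if q then -b else b) ≠ 0 ↔ (a * b = 1 ↔ p = q) := by
  revert a b p q; decide

/-! ### Truly stuck ⇒ unanimous -/

section Stuck

variable (β : Fin N → Fin N → ZMod 3) (U A : Finset (Fin N))

/-- "Truly stuck on `A`": no pair move inside `A`, under any pattern, has a successor other than `∅` or `U`. -/
def Stuck : Prop :=
  ∀ i ∈ A, ∀ j ∈ A, i ≠ j → ∀ p q : Bool, pairSurv β U i j p q = ∅ ∨ pairSurv β U i j p q = U

variable {β U A}

/-- Auxiliary `mem_pairSurv` (qn-lit g29 L-36 E, `AffBells29Stuck.lean` sha16 e9c93a609284989d, verbatim). -/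
theorem mem_pairSurv {i j : Fin N} {p q : Bool} {h : Fin N} :
    h ∈ pairSurv β U i j p q ↔ h ∈ U ∧ sval β p h i + sval β q h j ≠ 0 := mem_filter

/-- If some member survives a move, a stuck `U` survives it entirely. -/
theorem all_of_one (hS : Stuck β U A) {i j : Fin N} (hi : i ∈ A) (hj : j ∈ A) (hij : i ≠ j) (p q : Bool) {h : Fin N}
    (hh : h ∈ U) (hsv : sval β p h i + sval β q h j ≠ 0) : ∀ h' ∈ U, sval β p h' i + sval β q h' j ≠ 0 := by
  intro h' hh'
  rcases hS i hi j hj hij p q with he | hu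
  · have : h ∈ pairSurv β U i j p q := mem_pairSurv.2 ⟨hh, hsv⟩
    rw [he] at this; simp at this
  · have : h' ∈ pairSurv β U i j p q := by rw [hu]; exact hh'
    exact (mem_pairSurv.1 this).2

/-- **Column supports are trivial:** in a stuck `U` (with `|A| ≥ 3`), every coin of `A` is read by all of `U` or by none. -/
theorem stuck_support (hS : Stuck β U A) (hA : 3 ≤ A.card) {i : Fin N} (hi : i ∈ A) :
    (∀ h ∈ U, β h i ≠ 0) ∨ (∀ h ∈ U, β h i = 0) := by
  by_contra hcon
  push Not at hcon
  obtain ⟨⟨h₁, hh₁, h₁i⟩, ⟨h₂, hh₂, h₂i⟩⟩ := hcon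
  -- `h₁` blind at `i`, `h₂` reads `i`... (names as obtained: h₁i : β h₁ i = 0, h₂i : β h₂ i ≠ 0)
  -- two further distinct coins j, j' of A
  obtain ⟨j, hj, hji⟩ : ∃ j ∈ A, j ≠ i := by
    by_contra hno; push Not at hno
    have : A ⊆ {i} := fun a ha => mem_singleton.2 (hno a ha)
    have := card_le_card this; simp at this; omega
  obtain ⟨j', hj', hj'i, hj'j⟩ : ∃ j' ∈ A, j' ≠ i ∧ j' ≠ j := by
    by_contra hno; push Not at hno
    have : A ⊆ {i, j} := fun a ha => by
      by_cases hai : a = i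
      · simp [hai]
      · simp [hno a ha hai]
    have := card_le_card this
    have h2 : ({i, j} : Finset (Fin N)).card ≤ 2 := card_insert_le _ _
    omega
  -- at the pair (i, j): h₂ reads i; if h₂ also read j it would survive some pattern, forcing h₁ (blind at i) to read j with ... ;
  -- we show: β h₂ j = 0 and β h₁ j ≠ 0 (all one-readers), and the same for j'.
  have step : ∀ j ∈ A, j ≠ i → β h₂ j = 0 ∧ β h₁ j ≠ 0 := by
    intro j hj hji
    -- h₂ survives the pattern making it a survivor: if β h₂ j = 0 it is a one-reader (survives all); else pick bits with (a*b=1 ↔ p=q).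
    have h₂surv : ∃ p q : Bool, sval β p h₂ i + sval β q h₂ j ≠ 0 := by
      by_cases hb : β h₂ j = 0
      · exact ⟨false, false, by unfold sval; exact surv_one_reader _ _ (Or.inl ⟨h₂i, hb⟩) false false⟩
      · by_cases hr : β h₂ i * β h₂ j = 1
        · exact ⟨false, false, by unfold sval; exact (surv_both_iff _ _ h₂i hb false false).2 (by simp [hr])⟩
        · exact ⟨false, true, by unfold sval; exact (surv_both_iff _ _ h₂i hb false true).2 (by simp [hr])⟩
    obtain ⟨p, q, hpq⟩ := h₂surv
    have hall := all_of_one hS hi hj hji.symm p q hh₂ hpq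
    -- h₁ is blind at i, survives ⇒ reads j
    have h₁j : β h₁ j ≠ 0 := by
      intro hb
      exact hall h₁ hh₁ (by unfold sval; exact kill_blind _ _ h₁i hb p q)
    -- if h₂ read j, then under the OTHER sign type h₂ dies while h₁ (one-reader: blind at i, reads j) survives — contradiction with Stuck
    have h₂j : β h₂ j = 0 := by
      by_contra hb
      -- pattern under which h₂ dies
      have hdie : ∃ p' q' : Bool, sval β p' h₂ i + sval β q' h₂ j = 0 := by
        by_cases hr : β h₂ i * β h₂ j = 1
        · refine ⟨false, true, ?_⟩
          by_contra hne
          have := (surv_both_iff _ _ h₂i hb false true).1 (by unfold sval at hne; exact hne)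
          simp [hr] at this
        · refine ⟨false, false, ?_⟩
          by_contra hne
          have := (surv_both_iff _ _ h₂i hb false false).1 (by unfold sval at hne; exact hne)
          simp [hr] at this
      obtain ⟨p', q', hd⟩ := hdie
      have h₁surv : sval β p' h₁ i + sval β q' h₁ j ≠ 0 := by
        unfold sval; exact surv_one_reader _ _ (Or.inr ⟨h₁i, h₁j⟩) p' q'
      exact hall' hd (all_of_one hS hi hj hji.symm p' q' hh₁ h₁surv h₂ hh₂)
    exact ⟨h₂j, h₁j⟩
  obtain ⟨h₂j, h₁j⟩ := step j hj hji
  obtain ⟨h₂j', h₁j'⟩ := step j' hj' hj'i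
  -- at the pair (j, j'): h₂ is blind on both (dies always), h₁ reads both (survives some pattern) — contradiction
  have h₁surv : ∃ p q : Bool, sval β p h₁ j + sval β q h₁ j' ≠ 0 := by
    by_cases hr : β h₁ j * β h₁ j' = 1
    · exact ⟨false, false, by unfold sval; exact (surv_both_iff _ _ h₁j h₁j' false false).2 (by simp [hr])⟩
    · exact ⟨false, true, by unfold sval; exact (surv_both_iff _ _ h₁j h₁j' false true).2 (by simp [hr])⟩
  obtain ⟨p, q, hpq⟩ := h₁surv
  have := all_of_one hS hj hj' hj'j.symm p q hh₁ hpq h₂ hh₂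
  exact this (by unfold sval; exact kill_blind _ _ h₂j h₂j' p q)
where
  hall' {a : ZMod 3} (h0 : a = 0) (h1 : a ≠ 0) : False := h1 h0

/-- **Common ratios:** in a stuck `U`, on two coins read by all of `U` every two rows have the same ratio. -/
theorem stuck_ratio (hS : Stuck β U A) {i j : Fin N} (hi : i ∈ A) (hj : j ∈ A) (hij : i ≠ j)
    (hri : ∀ h ∈ U, β h i ≠ 0) (hrj : ∀ h ∈ U, β h j ≠ 0) {h h' : Fin N} (hh : h ∈ U) (hh' : h' ∈ U) :
    β h i * β h j = β h' i * β h' j := by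
  -- pattern under which h survives; then h' survives too; translate via `surv_both_iff`
  by_cases hr : β h i * β h j = 1
  · have hs : sval β false h i + sval β false h j ≠ 0 := by
      unfold sval; exact (surv_both_iff _ _ (hri h hh) (hrj h hh) false false).2 (by simp [hr])
    have hs' := all_of_one hS hi hj hij false false hh hs h' hh'
    have := (surv_both_iff _ _ (hri h' hh') (hrj h' hh') false false).1 (by unfold sval at hs'; exact hs')
    rw [hr]; exact (this.2 rfl).symm
  · have hs : sval β false h i + sval β true h j ≠ 0 := by
      unfold sval; exact (surv_both_iff _ _ (hri h hh) (hrj h hh) false true).2 (by simp [hr])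
    have hs' := all_of_one hS hi hj hij false true hh hs h' hh'
    have h2 := (surv_both_iff _ _ (hri h' hh') (hrj h' hh') false true).1 (by unfold sval at hs'; exact hs')
    -- both ratios are ≠ 1, hence both = 2 (non-zero elements of ZMod 3 have product in {1,2})
    have hr' : β h' i * β h' j ≠ 1 := fun e => by simp [e] at h2
    have key : ∀ a b : ZMod 3, a ≠ 0 → b ≠ 0 → a * b ≠ 1 → a * b = 2 := by decide
    rw [key _ _ (hri h hh) (hrj h hh) hr, key _ _ (hri h' hh') (hrj h' hh') hr']

/-- **TRULY STUCK ⇒ LOCAL `±`-TWIN CLASS (PROVED):** any two rows of a stuck survivor set are `LocTwin` or `LocAnti` on `A`. -/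
theorem stuck_locTwin (hS : Stuck β U A) (hA : 3 ≤ A.card) {h k : Fin N} (hh : h ∈ U) (hk : k ∈ U) :
    LocTwin β A h k ∨ LocAnti β A h k := by
  by_cases hR : ∃ i₀ ∈ A, ∀ h ∈ U, β h i₀ ≠ 0
  · obtain ⟨i₀, hi₀, hri₀⟩ := hR
    -- ε := β h i₀ * β k i₀ ∈ {1, 2}
    by_cases hε : β h i₀ * β k i₀ = 1
    · left
      intro i hi
      rcases stuck_support hS hA hi with hri | hbi
      · by_cases hii : i = i₀
        · subst hii
          have key : ∀ a b : ZMod 3, a ≠ 0 → b ≠ 0 → a * b = 1 → a = b := by decide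
          exact key _ _ (hri₀ h hh) (hri₀ k hk) hε
        · have hrat := stuck_ratio hS hi hi₀ hii hri hri₀ hh hk
          have key : ∀ b b' : ZMod 3, b ≠ 0 → b' ≠ 0 → b * b' = 1 → b = b' := by decide
          have hbb : β h i₀ = β k i₀ := key _ _ (hri₀ h hh) (hri₀ k hk) hε
          rw [hbb] at hrat
          exact mul_right_cancel₀ (hri₀ k hk) hrat
      · rw [hbi h hh, hbi k hk]
    · right
      have hε2 : β h i₀ * β k i₀ = 2 := by
        have key : ∀ a b : ZMod 3, a ≠ 0 → b ≠ 0 → a * b ≠ 1 → a * b = 2 := by decide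
        exact key _ _ (hri₀ h hh) (hri₀ k hk) hε
      intro i hi
      rcases stuck_support hS hA hi with hri | hbi
      · by_cases hii : i = i₀
        · subst hii
          have key : ∀ a b : ZMod 3, a ≠ 0 → b ≠ 0 → a * b = 2 → a = -b := by decide
          exact key _ _ (hri₀ h hh) (hri₀ k hk) hε2
        · have hrat := stuck_ratio hS hi hi₀ hii hri hri₀ hh hk
          have key : ∀ b b' : ZMod 3, b ≠ 0 → b' ≠ 0 → b * b' = 2 → b = -b' := by decide
          have hbb : β h i₀ = -β k i₀ := key _ _ (hri₀ h hh) (hri₀ k hk) hε2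
          rw [hbb, mul_neg, ← neg_mul] at hrat
          have h1 : -β h i = β k i := mul_right_cancel₀ (hri₀ k hk) hrat
          rw [← h1, neg_neg]
      · rw [hbi h hh, hbi k hk]; simp
  · -- no coin of A is read by all ⇒ (by `stuck_support`) every coin is read by none ⇒ all rows vanish on A ⇒ LocTwin
    left
    intro i hi
    rcases stuck_support hS hA hi with hri | hbi
    · exact absurd ⟨i, hi, hri⟩ hR
    · rw [hbi h hh, hbi k hk]

end Stuck

end AffBells29lit

end Summit.QuantumAdvantage.AdviceFreeQNC0
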